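import Literature.Combinatorics.Sahi2008.Marginals
import Literature.Probability.LatticeModels.RandomClusterMonotonic
import Summits.CriticalPhenomena.PercolationContinuityZ3.Theorems.PercNearOneGluingNoHeavyLowerTailSahiCubeThreeAllOrders

/-!
# Sahi's `C_n` for observables of at most three fixed EDGES of the random-cluster model (`q ≥ 1`)

Companion of `SahiThreeCoordinates.lean` (cell `prim-sahi`, typer; `--supports stmt-CriticalPhenomena-4575`).
Theorems only (no definitions, no named facts, no sorries).

The random-cluster weight of the tree (`Literature.Probability.LatticeModels.rcWeight G p q B`,
`0 ≤ p ≤ 1`, `q ≥ 1`, any wired set `B`, extended by `0` off the edge sets of the finite graph `G`) satisfies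
the FKG lattice condition on the distributive lattice `Finset (Sym2 V)` of edge sets
(`rcWeight_lattice_condition`, Grimmett 2006 Thm. 3.8 (3.11)); so its normalisation is an FKG probability
weight (`isFKGMeasure_rcGibbsWeight`) whose expectation of an indicator is the random-cluster probability
(`rcMeasure_real_eq_sum_indicator_mul`).  With P1's `SahiCubeAllOrders.sahiPositive_cube_three` (Sahi's
Conjecture 5 on `{0,1}³`, every FKG weight, every order) and the Karlin–Rinott marginal theorem
(`sahiE_comp_nonneg_of_forall_isFKGMeasure`):

* `rc_sahiE_threeEdges_nonneg` — for any three edges `e₀, e₁, e₂` (repetitions allowed) and EVERY `n`, every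
  family of nonnegative functions of the three open/closed bits `(1_{e₀ ∈ ω}, 1_{e₁ ∈ ω}, 1_{e₂ ∈ ω})`,
  nondecreasing in each bit, has `E_n ≥ 0` under `φ^B_{G,p,q}`;
* `rcMeasure_sahiC3_threeEdges` — the case `n = 3` with the three open-edge events `O_e = {ω : e ∈ ω}`:
  `0 ≤ 2φ(O₀ ∩ O₁ ∩ O₂) + φ(O₀)φ(O₁)φ(O₂) − φ(O₀)φ(O₁ ∩ O₂) − φ(O₁)φ(O₀ ∩ O₂) − φ(O₂)φ(O₀ ∩ O₁)`.

SCOPE: fixed edges only (three Birkhoff coordinates of `{0,1}^E`); at `q = 1` (product measure) this is P1's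
cube theorem; connectivity events are not reached.
-/

noncomputable section

namespace Summit.CriticalPhenomena.PercolationContinuityZ3.Theorems.SahiThreeCoordinates

open Finset Literature.Combinatorics.Sahi2008

section RandomCluster

open MeasureTheory Literature.Probability.LatticeModels

variable {V : Type*} [Fintype V] [DecidableEq V] (Gr : SimpleGraph V) [DecidableRel Gr.Adj]

/-- **The normalised random-cluster weight is an FKG probability weight** on the lattice of edge sets
(`0 ≤ p ≤ 1`, `q ≥ 1`, any wired set). -/
theorem isFKGMeasure_rcGibbsWeight {p q : ℝ} (hp : p ∈ Set.Icc (0 : ℝ) 1) (hq : 1 ≤ q) (B : Set V) :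
    IsFKGMeasure fun ω : Finset (Sym2 V) =>
      (if ω ⊆ Gr.edgeFinset then rcWeight Gr p q B ω else 0) / rcPartitionFunction Gr p q B := by
  have hq0 : 0 < q := one_pos.trans_le hq
  have hZ := rcPartitionFunction_pos Gr hp hq0 B
  refine ⟨fun ω => div_nonneg (rcWeight_ite_nonneg Gr hp hq0.le B ω) hZ.le, ?_, fun a b => ?_⟩
  · have hfilter : (Finset.univ : Finset (Finset (Sym2 V))).filter (· ⊆ Gr.edgeFinset) =
        Gr.edgeFinset.powerset := by
      ext ω; simp
    rw [← Finset.sum_div, ← Finset.sum_filter, hfilter, div_eq_one_iff_eq hZ.ne']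
    rfl
  · rw [div_mul_div_comm, div_mul_div_comm]
    exact div_le_div_of_nonneg_right (rcWeight_lattice_condition Gr hp hq B a b) (mul_nonneg hZ.le hZ.le)

/-- **Expectation of an indicator** under the normalised weight is the random-cluster probability. -/
theorem ex_rcGibbsWeight_indicator {p q : ℝ} (hp : p ∈ Set.Icc (0 : ℝ) 1) (hq : 0 < q) (B : Set V)
    (A : Set (Literature.Probability.Percolation.BondConfig V)) [DecidablePred (· ∈ A)] :
    ex (fun ω : Finset (Sym2 V) =>
        (if ω ⊆ Gr.edgeFinset then rcWeight Gr p q B ω else 0) / rcPartitionFunction Gr p q B)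
      (fun ω => if (↑ω : Literature.Probability.Percolation.BondConfig V) ∈ A then (1 : ℝ) else 0) = (rcMeasure Gr p q B).real A := by
  rw [rcMeasure_real_eq_sum_indicator_mul Gr hp hq B A, ex]
  exact Finset.sum_congr rfl fun ω _ => mul_comm _ _

/-- **Random-cluster model, three edges, every order.**  For `0 ≤ p ≤ 1`, `q ≥ 1`, any wired set `B`, any
edges `e₀, e₁, e₂` (repetitions allowed, edges outside `G` allowed — their bit is a.s. `0`), every `n` and all
nonnegative functions `g₀,…,g_{n−1}` of the three bits `(1_{e_a ∈ ω})_a ∈ {0,1}³` nondecreasing in each bit: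
`E_n^{φ}(g₀, …, g_{n−1}) ≥ 0`. -/
theorem rc_sahiE_threeEdges_nonneg {p q : ℝ} (hp : p ∈ Set.Icc (0 : ℝ) 1) (hq : 1 ≤ q) (B : Set V)
    (e : Fin 3 → Sym2 V) (n : ℕ) (g : Fin n → (Fin 3 → Bool) → ℝ) (hg0 : ∀ i y, 0 ≤ g i y)
    (hmono : ∀ i, Monotone (g i)) :
    0 ≤ sahiE (fun ω : Finset (Sym2 V) =>
        (if ω ⊆ Gr.edgeFinset then rcWeight Gr p q B ω else 0) / rcPartitionFunction Gr p q B) n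
      fun i ω => g i fun a => decide (e a ∈ ω) :=
  sahiE_comp_nonneg_of_forall_isFKGMeasure (isFKGMeasure_rcGibbsWeight Gr hp hq B)
    { toFun := fun (ω : Finset (Sym2 V)) (a : Fin 3) => decide (e a ∈ ω)
      map_sup' := fun ω ω' => by
        funext a
        simp only [Pi.sup_apply, Finset.sup_eq_union, Finset.mem_union, Bool.decide_or]
        rfl
      map_inf' := fun ω ω' => by
        funext a
        simp only [Pi.inf_apply, Finset.inf_eq_inter, Finset.mem_inter, Bool.decide_and]
        rfl }
    (fun _ hν => SahiCubeAllOrders.sahiPositive_cube_three hν n) g hg0 hmono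

/-- **`C₃` for three open-edge events of the random-cluster model** (`0 ≤ p ≤ 1`, `q ≥ 1`, any wired set, any
edges `e₀ e₁ e₂`), `O_e = {ω : e ∈ ω}`:
`0 ≤ 2φ(O₀ ∩ O₁ ∩ O₂) + φ(O₀)φ(O₁)φ(O₂) − φ(O₀)φ(O₁ ∩ O₂) − φ(O₁)φ(O₀ ∩ O₂) − φ(O₂)φ(O₀ ∩ O₁)`. -/
theorem rcMeasure_sahiC3_threeEdges {p q : ℝ} (hp : p ∈ Set.Icc (0 : ℝ) 1) (hq : 1 ≤ q) (B : Set V)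
    (e₀ e₁ e₂ : Sym2 V) :
    0 ≤ 2 * (rcMeasure Gr p q B).real {ω | e₀ ∈ ω ∧ e₁ ∈ ω ∧ e₂ ∈ ω} +
        (rcMeasure Gr p q B).real {ω | e₀ ∈ ω} * (rcMeasure Gr p q B).real {ω | e₁ ∈ ω} *
          (rcMeasure Gr p q B).real {ω | e₂ ∈ ω} -
        ((rcMeasure Gr p q B).real {ω | e₀ ∈ ω} * (rcMeasure Gr p q B).real {ω | e₁ ∈ ω ∧ e₂ ∈ ω} +
          (rcMeasure Gr p q B).real {ω | e₁ ∈ ω} * (rcMeasure Gr p q B).real {ω | e₀ ∈ ω ∧ e₂ ∈ ω} +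
          (rcMeasure Gr p q B).real {ω | e₂ ∈ ω} * (rcMeasure Gr p q B).real {ω | e₀ ∈ ω ∧ e₁ ∈ ω}) := by
  classical
  have hq0 : 0 < q := one_pos.trans_le hq
  set μ : Finset (Sym2 V) → ℝ := fun ω =>
    (if ω ⊆ Gr.edgeFinset then rcWeight Gr p q B ω else 0) / rcPartitionFunction Gr p q B with hμ
  -- Sahi's `C₃` for the three bit-indicators
  have key := rc_sahiE_threeEdges_nonneg Gr hp hq B ![e₀, e₁, e₂] 3 (fun a y => if y a then 1 else 0)
    (fun a y => by split_ifs <;> norm_num)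
    (fun a y y' hyy' => by
      have ha : y a ≤ y' a := hyy' a
      show (if y a = true then (1 : ℝ) else 0) ≤ if y' a = true then 1 else 0
      cases hya : y a <;> cases hya' : y' a
      · simp
      · simp
      · rw [hya, hya'] at ha
        exact absurd ha (by decide)
      · simp)
  rw [sahiE_three_apply] at key
  simp only [Matrix.cons_val_zero, Matrix.cons_val_one, Matrix.cons_val_two, Matrix.head_cons,
    Matrix.tail_cons, decide_eq_true_eq] at key
  -- the seven moments are random-cluster probabilities
  have c0 : ex μ (fun ω => if e₀ ∈ ω then (1 : ℝ) else 0) = (rcMeasure Gr p q B).real {ω | e₀ ∈ ω} := by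
    rw [← ex_rcGibbsWeight_indicator Gr hp hq0 B]
    congr 1; funext ω
    simp only [Set.mem_setOf_eq, Finset.mem_coe]
  have c1 : ex μ (fun ω => if e₁ ∈ ω then (1 : ℝ) else 0) = (rcMeasure Gr p q B).real {ω | e₁ ∈ ω} := by
    rw [← ex_rcGibbsWeight_indicator Gr hp hq0 B]
    congr 1; funext ω
    simp only [Set.mem_setOf_eq, Finset.mem_coe]
  have c2 : ex μ (fun ω => if e₂ ∈ ω then (1 : ℝ) else 0) = (rcMeasure Gr p q B).real {ω | e₂ ∈ ω} := by
    rw [← ex_rcGibbsWeight_indicator Gr hp hq0 B]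
    congr 1; funext ω
    simp only [Set.mem_setOf_eq, Finset.mem_coe]
  have c01 : ex μ ((fun ω => if e₀ ∈ ω then (1 : ℝ) else 0) * fun ω => if e₁ ∈ ω then 1 else 0) =
      (rcMeasure Gr p q B).real {ω | e₀ ∈ ω ∧ e₁ ∈ ω} := by
    rw [← ex_rcGibbsWeight_indicator Gr hp hq0 B]
    congr 1; funext ω
    simp only [Pi.mul_apply, Set.mem_setOf_eq, Finset.mem_coe]
    by_cases h0 : e₀ ∈ ω <;> by_cases h1 : e₁ ∈ ω <;> simp [h0, h1]
  have c02 : ex μ ((fun ω => if e₀ ∈ ω then (1 : ℝ) else 0) * fun ω => if e₂ ∈ ω then 1 else 0) =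
      (rcMeasure Gr p q B).real {ω | e₀ ∈ ω ∧ e₂ ∈ ω} := by
    rw [← ex_rcGibbsWeight_indicator Gr hp hq0 B]
    congr 1; funext ω
    simp only [Pi.mul_apply, Set.mem_setOf_eq, Finset.mem_coe]
    by_cases h0 : e₀ ∈ ω <;> by_cases h2 : e₂ ∈ ω <;> simp [h0, h2]
  have c12 : ex μ ((fun ω => if e₁ ∈ ω then (1 : ℝ) else 0) * fun ω => if e₂ ∈ ω then 1 else 0) =
      (rcMeasure Gr p q B).real {ω | e₁ ∈ ω ∧ e₂ ∈ ω} := by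
    rw [← ex_rcGibbsWeight_indicator Gr hp hq0 B]
    congr 1; funext ω
    simp only [Pi.mul_apply, Set.mem_setOf_eq, Finset.mem_coe]
    by_cases h1 : e₁ ∈ ω <;> by_cases h2 : e₂ ∈ ω <;> simp [h1, h2]
  have c012 : ex μ (((fun ω => if e₀ ∈ ω then (1 : ℝ) else 0) * fun ω => if e₁ ∈ ω then 1 else 0) *
      fun ω => if e₂ ∈ ω then 1 else 0) = (rcMeasure Gr p q B).real {ω | e₀ ∈ ω ∧ e₁ ∈ ω ∧ e₂ ∈ ω} := by
    rw [← ex_rcGibbsWeight_indicator Gr hp hq0 B]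
    congr 1; funext ω
    simp only [Pi.mul_apply, Set.mem_setOf_eq, Finset.mem_coe]
    by_cases h0 : e₀ ∈ ω <;> by_cases h1 : e₁ ∈ ω <;> by_cases h2 : e₂ ∈ ω <;> simp [h0, h1, h2]
  rw [c0, c1, c2, c01, c02, c12, c012] at key
  exact key

end RandomCluster

end Summit.CriticalPhenomena.PercolationContinuityZ3.Theorems.SahiThreeCoordinates
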